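import Summits.ABC.IUTFork.Cor312PinnedSetting
import Summits.ABC.IUTFork.Cor312IdentifiedNonVacuity
import HarnessLib

/-!
# [IUTchIII] Cor. 3.12 — the SPLIT natural model P♮₁ of the residual `S`, I: split shells, coordinates, capsule permutations

Record-only file (D-0012; MODEL DATA, no `Prop` fact) of the abc-iut cell (wave 5, seat abc-iut-w5-d230 gen 4 = PR-1 lineage; by-name
support piece for the IUT REPAIR branch, director-abc 2026-08-26T05:11:48Z; sequel of this seat's P♮ `Cor312PilotKummerNaturalModel`
p429252 / p429573 / p429651 = rp-plan REPAIR-SPEC v0.3 profile point (e)). TAKES NO SIDE on [IUTchIII] Cor. 3.12.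

WHY A SECOND MODEL. P♮ shows at interface level that `S = PilotKummerIndRelated` does not force the identified-copies collapse, but
its moving indeterminacy is the SIGN `−1 ∈ Ism` acting on a sign-ASYMMETRIC toy region (its own scope note; abc-iut-w5-d068's junction
note 06:44:55Z «honest limits of (e)»). In print the Θ-pilot's region is `𝒪^×`-stable and the indeterminacy that MOVES it is (Ind1):
«the automorphisms of the procession of 𝒟^⊢-prime-strips» ([IUTchIII] Thm. 3.11 (i) p. 154), which PERMUTE THE CAPSULE INDICES
`S^±_{j+1}` of the tensor packet `log(^{S^±_{j+1}}𝒟^⊢_{v_ℚ}) = ⊗_{i ∈ S^±_{j+1}} log(𝒟^⊢_{i,v_ℚ})` (Prop. 3.2) — the theta value sitting in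
ONE factor (the sub-packet `𝓘^ℚ(^{S^±_{j+1},j};−)`, Prop. 3.4 (ii)), so that on a SPLIT packet (several valuations over `v_ℚ`) its
permutation-translates are DISTINCT regions of equal volume whose holomorphic hull is strictly larger ([IUTchIV] Thm. 1.10 Step (v)
«symmetrizing with respect to the choice of `i† ∈ I`»; [cite: DupuyHilado2020, §4.7]; the cell's L-DH «least-slot» window
`LDHBadMassWindow`). P♮₁ realises exactly this mechanism at interface level: index `splitIndex` = TWO valuations over one place
(so the 1-packet is `ℚ²` and the `(j+1)`-packet `(ℚ²)^{⊗(j+1)}` has the `2^{j+1}` coordinates `coord c`, `c : S^±_{j+1} → Bool`),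
TRIVIAL Ism and strip-automorphisms (all movement is (Ind1)), hull-sets the BOXES `box D` («deep» — `|coord c| ≤ 1` — exactly on
`c ∈ D`, `|coord c| ≤ 8` elsewhere; `∩`-closed, permutation-stable), log-volume `−1 − #D` (monotone, permutation-invariant), Θ-datum the
pure tensor `thetaPt` with its theta value in the LAST factor, supported on the bad summand (so `PsiInSubPackets` holds honestly), whose
box is `box {c | c(j) = false}`; the (Ind1)-family `swapFamily` (swap of the capsule indices `0` and `j`) carries it to the DISTINCT
box `box {c | c(0) = false}` = the q-pilot's region. Sequels (`…SplitThm311`, `…SplitWitness`): typed Thm. 3.11, `S` through that ONE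
capsule permutation, the three pins, the Statement STRICT. HONEST SCOPE: interface-level toy (l⋇ = 2, two places, toy volumes — the Θ/q
volume ratio is `1`, not `j²`, and the q-volume is label-dependent); it models the MECHANISM of (Ind1), not [IUTchI] Def. 3.1 data.
[claim: Mochizuki2012, status: disputed] for every IUT noun.
-/

noncomputable section

open Set

namespace Summit.ABC.IUTFork.Cor312Vol

namespace SplitWitness

open Thm311 Cor312 Cor312.IdentifiedNonVacuity NaiveWitness PinnedWitness Literature.IUT.LogThetaLattice

/-! ## 1. The split index, the shells, the coordinates, the permutation action -/

/-- The SPLIT index: `l⋇ = 2`, TWO valuations (`Bool`) over ONE place, both nonarchimedean, bad place `true`. (An `abbrev`, so that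
`splitIndex.V = Bool`, `splitIndex.VQ = Unit` reduce for instance search.) [claim: Mochizuki2012, status: disputed] -/
abbrev splitIndex : ThetaIndex where
  lstar := 2
  two_le_lstar := le_rfl
  V := Bool
  VQ := Unit
  over := fun _ => ()
  IsNon := fun _ => True
  fibre_finite := fun _ => Set.toFinite _
  fibre_nonempty := fun _ => ⟨true, rfl⟩
  Vbad := {true}
  Vbad_nonempty := ⟨true, rfl⟩
  Vbad_finite := Set.toFinite _
  Vbad_non := fun _ _ => trivial

/-- The SPLIT shells: `log(𝒟^⊢_v) := ℚ` at both valuations, unit-ball log-shell, TRIVIAL strip-automorphisms and Ism — every movement of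
regions in P♮₁ comes from (Ind1)'s capsule permutations. (An `abbrev`.) [claim: Mochizuki2012, status: disputed] -/
abbrev splitShells : LogShells splitIndex where
  carrier := fun _ => ℚ
  shell := fun _ => {x | |x| ≤ 1}
  stripAut := fun _ => {LinearEquiv.refl ℚ ℚ}
  ism := fun _ => {LinearEquiv.refl ℚ ℚ}
  one_mem_stripAut := fun _ => rfl
  one_mem_ism := fun _ => rfl

/-- The two points of every fibre. [folklore] -/
def fib (vQ : splitIndex.VQ) (b : Bool) : splitIndex.Fibre vQ := ⟨b, rfl⟩

/-- The COORDINATE FUNCTIONAL of the `(j+1)`-packet `(ℚ²)^{⊗(j+1)}` indexed by `c : S^±_{j+1} → Bool`: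
`x_0 ⊗ ⋯ ⊗ x_j ↦ ∏_i x_i(c i)`. [folklore] -/
def coord (j : splitIndex.Label) (vQ : splitIndex.VQ) (c : splitIndex.Caps j → Bool) : splitShells.Packet j vQ →ₗ[ℚ] ℚ :=
  PiTensorProduct.lift
    ((MultilinearMap.mkPiAlgebra ℚ (splitIndex.Caps j) ℚ).compLinearMap fun i =>
      (LinearMap.proj (fib vQ (c i)) : splitShells.Packet1 vQ →ₗ[ℚ] ℚ))

/-- The coordinate of a pure tensor is the product of the factors' components. [folklore] -/
theorem coord_tprod (j : splitIndex.Label) (vQ : splitIndex.VQ) (c : splitIndex.Caps j → Bool)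
    (x : splitIndex.Caps j → splitShells.Packet1 vQ) :
    coord j vQ c (PiTensorProduct.tprod ℚ x) = ∏ i, x i (fib vQ (c i)) := by
  unfold coord
  erw [PiTensorProduct.lift.tprod]
  simp only [MultilinearMap.compLinearMap_apply, MultilinearMap.mkPiAlgebra_apply]
  rfl

/-- **A capsule permutation acts on the coordinates by precomposition**: `coord c (σ·x) = coord (c ∘ σ) x`
(Dupuy–Hilado §4.7: (Ind1) permutes the tensor factors). [folklore] -/
theorem coord_permute (j : splitIndex.Label) (vQ : splitIndex.VQ) (σ : Equiv.Perm (splitIndex.Caps j))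
    (c : splitIndex.Caps j → Bool) (x : splitShells.Packet j vQ) :
    coord j vQ c (splitShells.permute j vQ σ x) = coord j vQ (c ∘ σ) x := by
  have h : (coord j vQ c).comp (splitShells.permute j vQ σ).toLinearMap = coord j vQ (c ∘ σ) := by
    apply PiTensorProduct.ext
    ext y
    simp only [LinearMap.compMultilinearMap_apply]
    show coord j vQ c (splitShells.permute j vQ σ (splitShells.tprod j vQ y)) = coord j vQ (c ∘ σ) (PiTensorProduct.tprod ℚ y)
    rw [splitShells.permute_tprod]
    show coord j vQ c (PiTensorProduct.tprod ℚ fun i => y (σ.symm i)) = _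
    rw [coord_tprod, coord_tprod]
    exact Fintype.prod_equiv σ.symm _ _ fun i => by rw [Function.comp_apply, Equiv.apply_symm_apply]
  exact congrArg (fun f : splitShells.Packet j vQ →ₗ[ℚ] ℚ => f x) h

/-- A packet-automorphism family ACTS BY CAPSULE PERMUTATIONS if on every packet it is `permute σ` for some `σ ∈ Perm(S^±_{j+1})` —
the property propagated through the group generated by (Ind1), (Ind2) (a bookkeeping predicate, not a fact). [folklore] -/
def ActsByPerm (Φ : splitShells.PacketAut) : Prop :=
  ∀ (j : splitIndex.Label) (vQ : splitIndex.VQ), ∃ σ : Equiv.Perm (splitIndex.Caps j),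
    ∀ x, Φ j vQ x = splitShells.permute j vQ σ x

/-- A summand-wise automorphism by identities is the identity. [folklore] -/
theorem summandwise_refl' (vQ : splitIndex.VQ)
    (g : ∀ v : splitIndex.Fibre vQ, splitShells.carrier v.1 ≃ₗ[ℚ] splitShells.carrier v.1)
    (hg : ∀ v, g v ∈ ({LinearEquiv.refl ℚ ℚ} : Set (ℚ ≃ₗ[ℚ] ℚ))) :
    splitShells.summandwise vQ g = LinearEquiv.refl ℚ _ := by
  have : g = fun v => LinearEquiv.refl ℚ (splitShells.carrier v.1) := funext fun v => hg v
  rw [this]; exact splitShells.summandwise_refl vQ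

/-- An (Ind1)-family acts by capsule permutations (its strip-automorphism part is trivial here). [folklore] -/
theorem actsByPerm_of_mem_Ind1Family {Φ : splitShells.PacketAut} (h : Φ ∈ splitShells.Ind1Family) : ActsByPerm Φ := by
  intro j vQ
  obtain ⟨σ, g, hg, hΦ⟩ := h j
  refine ⟨σ, fun x => ?_⟩
  rw [show Φ j vQ = (splitShells.permute j vQ σ).trans
      (splitShells.factorwise j vQ fun i => splitShells.summandwise vQ fun v => g i v.1) from hΦ vQ]
  have hs : (fun i => splitShells.summandwise vQ fun v => g i v.1) = fun _ => LinearEquiv.refl ℚ (splitShells.Packet1 vQ) :=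
    funext fun i => summandwise_refl' vQ _ fun v => hg i v.1
  rw [hs, splitShells.factorwise_refl]
  rfl

/-- An (Ind2)-family acts trivially (Ism is trivial), i.e. by the identity permutation. [folklore] -/
theorem actsByPerm_of_mem_Ind2Family {Φ : splitShells.PacketAut} (h : Φ ∈ splitShells.Ind2Family) : ActsByPerm Φ := by
  intro j vQ
  refine ⟨Equiv.refl _, fun x => ?_⟩
  obtain ⟨g, hg, hΦ⟩ := h j vQ
  rw [hΦ]
  have hs : (fun i => splitShells.summandwise vQ (g i)) = fun _ => LinearEquiv.refl ℚ (splitShells.Packet1 vQ) :=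
    funext fun i => summandwise_refl' vQ _ fun v => hg i v
  rw [hs, splitShells.factorwise_refl, splitShells.permute_refl]

/-- The identity acts by permutations. [folklore] -/
theorem actsByPerm_one : ActsByPerm 1 :=
  fun j vQ => ⟨Equiv.refl _, fun x => by rw [splitShells.permute_refl]; rfl⟩

/-- Acting by permutations is closed under composition. [folklore] -/
theorem ActsByPerm.mul {Φ Ψ : splitShells.PacketAut} (hΦ : ActsByPerm Φ) (hΨ : ActsByPerm Ψ) : ActsByPerm (Φ * Ψ) := by
  intro j vQ
  obtain ⟨σ, hσ⟩ := hΦ j vQ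
  obtain ⟨τ, hτ⟩ := hΨ j vQ
  refine ⟨τ.trans σ, fun x => ?_⟩
  show Φ j vQ (Ψ j vQ x) = _
  rw [hτ, hσ]
  exact PiTensorProduct.reindex_reindex τ σ x

/-- Acting by permutations is closed under inverses. [folklore] -/
theorem ActsByPerm.inv {Φ : splitShells.PacketAut} (hΦ : ActsByPerm Φ) : ActsByPerm Φ⁻¹ := by
  intro j vQ
  obtain ⟨σ, hσ⟩ := hΦ j vQ
  refine ⟨σ.symm, fun x => ?_⟩
  show (Φ j vQ).symm x = _
  have h1 : Φ j vQ = splitShells.permute j vQ σ := LinearEquiv.ext hσ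
  rw [h1]
  show (PiTensorProduct.reindex ℚ (fun _ : splitIndex.Caps j => splitShells.Packet1 vQ) σ).symm x = _
  rw [PiTensorProduct.reindex_symm]
  rfl

/-- **Every element of the group generated by (Ind1), (Ind2) acts by capsule permutations.** [folklore] -/
theorem actsByPerm_of_mem_closure {Φ : splitShells.PacketAut}
    (h : Φ ∈ Subgroup.closure (splitShells.Ind1Family ∪ splitShells.Ind2Family)) : ActsByPerm Φ := by
  induction h using Subgroup.closure_induction with
  | mem Ψ hΨ =>
    rcases hΨ with h1 | h2
    · exact actsByPerm_of_mem_Ind1Family h1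
    · exact actsByPerm_of_mem_Ind2Family h2
  | one => exact actsByPerm_one
  | mul Ψ Ψ' _ _ hΨ hΨ' => exact hΨ.mul hΨ'
  | inv Ψ _ hΨ => exact hΨ.inv

/-- The (Ind1)-family permuting every capsule by a given family of permutations. [claim: Mochizuki2012, status: disputed] -/
def permFamily (σ : ∀ j : splitIndex.Label, Equiv.Perm (splitIndex.Caps j)) : splitShells.PacketAut :=
  fun j vQ => splitShells.permute j vQ (σ j)

/-- `permFamily σ` is an (Ind1)-family (capsule permutations with identity strip-automorphisms). [folklore] -/
theorem permFamily_mem_Ind1Family (σ : ∀ j : splitIndex.Label, Equiv.Perm (splitIndex.Caps j)) :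
    permFamily σ ∈ splitShells.Ind1Family := fun j =>
  ⟨σ j, fun _ _ => LinearEquiv.refl ℚ ℚ, fun _ _ => rfl, fun vQ => by
    rw [splitShells.summandwise_refl_family, splitShells.factorwise_refl]; rfl⟩

/-- The swap of the capsule indices `0` and `j` (the last one) at every label — the (Ind1)-move of P♮₁.
[claim: Mochizuki2012, status: disputed] -/
def swapLast (j : splitIndex.Label) : Equiv.Perm (splitIndex.Caps j) := Equiv.swap 0 (Fin.last _)

/-- The (Ind1)-family `swapFamily` swapping the first and last capsule index at every label. [claim: Mochizuki2012, status: disputed] -/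
def swapFamily : splitShells.PacketAut := permFamily swapLast

end SplitWitness

end Summit.ABC.IUTFork.Cor312Vol

end
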